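import Literature.Analysis.FluidPDE.CKNVelocityIntegrability
import HarnessLib

/-!
# Translation of weak derivatives; the Sobolev inequality `H¹(B_ρ(y)) ⊂ L⁶` uniformly in `y`

Analysis/FluidPDE support file (serves the decomposition of the named fact
`Literature.Analysis.FluidPDE.leray_solution_ckn_decay`, `LerayFarFieldEpsilonRegularity.lean`:
the decay of `∫₀ᵀ ∫_{B_ρ(y)} |v|³` as `|y| → ∞` for a local Leray solution is obtained
slice-wise from the Sobolev inequality on the balls `B_ρ(y)` with a constant that does not
depend on the centre `y`, Kikuchi–Seregin 2007, proof of Lemma 2.2 / Kang–Miura–Tsai 2021,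
Lemma 3.3: "It is standard to see that `A` is finite by using properties 2–5 and the Sobolev
embedding").

* `hasWeakFDerivOn_comp_add_right` — **translation of weak derivatives**: if `g` is a weak
  derivative of `f` on the open set `Ω` (accepted
  `Literature.Analysis.FunctionSpaces.HasWeakFDerivOn`, Evans, *PDE*, §5.2.1), then
  `x ↦ g (x + y)` is a weak derivative of `x ↦ f (x + y)` on the translated open set
  `Ω - y = (· + y)⁻¹' Ω` (change of variables in the integration-by-parts identity; the
  Lebesgue measure is translation invariant);
* `exists_eLpNorm_six_le_ball_uniform` — **the Sobolev inequality on balls of `ℝ³`, uniformly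
  in the centre**: for every `ρ` there is `C = C(ρ)` such that for every centre `y`, every
  `f ∈ L²(B_ρ(y))` with weak derivative `g` on `B_ρ(y)`,
  `‖f‖_{L⁶(B_ρ(y))} ≤ C (‖f‖_{L²(B_ρ(y))} + (∫_{B_ρ(y)} |g|²)^{1/2})`
  (Robinson–Rodrigo–Sadowski 2016, Thm. 1.7 / (15.30): `H¹(B_r) ⊂ L⁶(B_r)`; the tree's
  `exists_eLpNorm_six_le_ball` (`CKNVelocityIntegrability.lean`) gives a constant depending on
  the ball, i.e. on its centre).
  Proof: the tree's inequality on the fixed ball `B_ρ(0)`, transported to `B_ρ(y)` by the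
  translation `x ↦ x + y` (measure preserving, `measurePreserving_add_right`).

## Mathlib / tree search

Tree: `exists_eLpNorm_six_le_unitBall` (`CKNInterpolationEstimate.lean`, centre `0`, radius `1`),
`exists_eLpNorm_six_le_ball` (`CKNVelocityIntegrability.lean`, constant depending on the ball),
`isLipschitzDomain_ball`, `exists_eLpNorm_le_of_memSobolevDomain_one`; no translation lemma for
`HasWeakFDerivOn` (`lean search 'HasWeakFDerivOn.*(comp_add|translate)'`: none; the space–time
analogue is `HasWeakSpatialGradientOn.stRescale`). Mathlib: `measurePreserving_add_right`,
`Homeomorph.addRight`, `MeasurePreserving.setIntegral_preimage_emb`,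
`MeasurePreserving.integrableOn_comp_preimage`, `MeasurePreserving.setLIntegral_comp_preimage_emb`,
`eLpNorm_comp_measurePreserving`, `fderiv_comp_add_right`, `locallyIntegrableOn_iff`.

## References

* L. C. Evans, *Partial Differential Equations*, 2nd ed., AMS (2010), §5.2.1 (weak derivatives).
* J. C. Robinson, J. L. Rodrigo, W. Sadowski, *The three-dimensional Navier–Stokes equations*,
  CUP (2016), Thm. 1.7, Lemma 15.10 (15.30).
* N. Kikuchi, G. Seregin, AMS Transl. (2) 220 (2007), Lemma 2.2; K. Kang, H. Miura, T.-P. Tsai,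
  IMRN 2021 = arXiv:1812.10509, Lemma 3.3.
-/

noncomputable section

open _root_.MeasureTheory _root_.TopologicalSpace _root_.Metric _root_.Filter _root_.Set
  _root_.Function
open scoped _root_.ENNReal _root_.NNReal _root_.Topology

namespace Literature.Analysis.FluidPDE

/-! ## Translation of test functions and of weak derivatives -/

section Translate

variable {E : Type*} [NormedAddCommGroup E] [InnerProductSpace ℝ E] [FiniteDimensional ℝ E]
  [MeasurableSpace E] [BorelSpace E]
variable {F : Type*} [NormedAddCommGroup F] [NormedSpace ℝ F]

omit [FiniteDimensional ℝ E] [MeasurableSpace E] [BorelSpace E] in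
/-- A test function on `Ω` composed with the translation `x ↦ x + a` is a test function on the
translated open set `(· + a)⁻¹' Ω` (Evans, *PDE*, §5.2.1). [folklore] -/
theorem isTestFunctionOn_comp_add_right {Ω Ω' : Opens E} (a : E)
    (hΩ' : ((Ω' : Opens E) : Set E) = (fun x => x + a) ⁻¹' (Ω : Set E)) {φ : E → ℝ}
    (hφ : FunctionSpaces.IsTestFunctionOn Ω φ) :
    FunctionSpaces.IsTestFunctionOn Ω' (fun x => φ (x + a)) where
  contDiff := hφ.contDiff.comp (contDiff_id.add contDiff_const)
  hasCompactSupport := hφ.hasCompactSupport.comp_homeomorph (Homeomorph.addRight a)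
  tsupport_subset := by
    have e : (fun x => φ (x + a)) = φ ∘ (Homeomorph.addRight a) := rfl
    rw [e, tsupport, support_comp_eq_preimage, ← Homeomorph.preimage_closure, hΩ']
    exact preimage_mono hφ.tsupport_subset

/-- Local integrability on `Ω` transports to local integrability of `x ↦ u (x + y)` on
`(· + y)⁻¹' Ω` (translation invariance of the Lebesgue measure). [folklore] -/
theorem locallyIntegrableOn_comp_add_right {Ω Ω' : Opens E} (y : E)
    (hΩ' : ((Ω' : Opens E) : Set E) = (fun x => x + y) ⁻¹' (Ω : Set E))
    {G : Type*} [NormedAddCommGroup G] {u : E → G}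
    (hu : LocallyIntegrableOn u (Ω : Set E) volume) :
    LocallyIntegrableOn (fun x => u (x + y)) (Ω' : Set E) volume := by
  have hτ : MeasurePreserving (fun x : E => x + y) volume volume :=
    measurePreserving_add_right volume y
  have hemb : MeasurableEmbedding (fun x : E => x + y) :=
    (Homeomorph.addRight y).measurableEmbedding
  have hcont : Continuous (fun x : E => x + y) := continuous_id.add continuous_const
  refine (locallyIntegrableOn_iff Ω'.isOpen.isLocallyClosed).2 fun K hK hKc => ?_
  have hK' : (fun x : E => x + y) '' K ⊆ (Ω : Set E) := by
    rintro _ ⟨x, hx, rfl⟩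
    have := hK hx
    rw [hΩ'] at this
    exact this
  have hI := hu.integrableOn_compact_subset hK' (hKc.image hcont)
  have := (hτ.integrableOn_comp_preimage hemb (f := u) (s := (fun x : E => x + y) '' K)).2 hI
  rwa [preimage_image_eq _ hemb.injective] at this

/-- **Translation of weak derivatives.** If `g` is a weak derivative of `f` on the open set
`Ω ⊆ E` (for the Lebesgue measure), then `x ↦ g (x + y)` is a weak derivative of
`x ↦ f (x + y)` on `Ω' = (· + y)⁻¹' Ω` (Evans, *PDE*, §5.2.1: the integration-by-parts
identity is invariant under the measure-preserving change of variables `x ↦ x + y`, a test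
function `φ` on `Ω'` corresponding to the test function `φ(· - y)` on `Ω`). [folklore] -/
theorem hasWeakFDerivOn_comp_add_right {Ω Ω' : Opens E} (y : E)
    (hΩ' : ((Ω' : Opens E) : Set E) = (fun x => x + y) ⁻¹' (Ω : Set E)) {f : E → F}
    {g : E → E →L[ℝ] F} (h : FunctionSpaces.HasWeakFDerivOn Ω volume f g) :
    FunctionSpaces.HasWeakFDerivOn Ω' volume (fun x => f (x + y)) (fun x => g (x + y)) := by
  have hτ : MeasurePreserving (fun x : E => x + y) volume volume :=
    measurePreserving_add_right volume y
  have hemb : MeasurableEmbedding (fun x : E => x + y) :=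
    (Homeomorph.addRight y).measurableEmbedding
  refine ⟨locallyIntegrableOn_comp_add_right y hΩ' h.locallyIntegrableOn,
    locallyIntegrableOn_comp_add_right y hΩ' h.locallyIntegrableOn_deriv, fun φ v hφ => ?_⟩
  -- the test function `φ(· - y)` on `Ω`
  have hΩ : ((Ω : Opens E) : Set E) = (fun x => x + -y) ⁻¹' (Ω' : Set E) := by
    rw [hΩ']
    ext x
    simp
  have hφ' := isTestFunctionOn_comp_add_right (-y) hΩ hφ
  have key := h.integral_fderiv_smul_eq _ v hφ'
  have hd : ∀ x : E, fderiv ℝ (fun x => φ (x + -y)) x v = fderiv ℝ φ (x + -y) v :=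
    fun x => by rw [fderiv_comp_add_right]
  simp_rw [hd] at key
  -- change variables `x ↦ x + y` on both sides
  have h1 :=
    hτ.setIntegral_preimage_emb hemb (fun x => (fderiv ℝ φ (x + -y) v) • f x) (Ω : Set E)
  have h2 := hτ.setIntegral_preimage_emb hemb (fun x => φ (x + -y) • g x v) (Ω : Set E)
  simp only [add_neg_cancel_right] at h1 h2
  rw [← hΩ'] at h1 h2
  rw [h1, h2]
  exact key

end Translate

/-! ## The Sobolev inequality on balls, uniformly in the centre -/

section Sobolev

variable {E : Type*} [NormedAddCommGroup E] [InnerProductSpace ℝ E] [FiniteDimensional ℝ E]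
  [MeasurableSpace E] [BorelSpace E]

/-- **Sobolev inequality on balls of a `3`-dimensional space, uniformly in the centre.** For
every `ρ` there is `C = C(ρ)` such that for every centre `y`, every `f ∈ L²(B_ρ(y))` with a
weak derivative `g` on `B_ρ(y)`,
`‖f‖_{L⁶(B_ρ(y))} ≤ C (‖f‖_{L²(B_ρ(y))} + (∫_{B_ρ(y)} |g|²)^{1/2})`
(Robinson–Rodrigo–Sadowski 2016, Thm. 1.7 / (15.30); Lemarié-Rieusset 2016, (13.17); the
centred case `exists_eLpNorm_six_le_ball … 0 ρ` transported by the translation `x ↦ x + y`,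
`hasWeakFDerivOn_comp_add_right`).
[cite: RobinsonRodrigoSadowski2016, Thm. 1.7 / Lemma 15.10 (15.30)] -/
theorem exists_eLpNorm_six_le_ball_uniform (hE3 : Module.finrank ℝ E = 3) (ρ : ℝ) :
    ∃ C : ℝ≥0, ∀ (y : E) (f : E → E) (g : E → E →L[ℝ] E),
      FunctionSpaces.HasWeakFDerivOn (⟨ball y ρ, isOpen_ball⟩ : Opens E) volume f g →
      eLpNorm f 2 (volume.restrict (ball y ρ)) ≠ ∞ →
      eLpNorm f 6 (volume.restrict (ball y ρ)) ≤
        C * (eLpNorm f 2 (volume.restrict (ball y ρ)) +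
          (∫⁻ x in ball y ρ, ENNReal.ofReal (frobeniusNormSq (g x))) ^ (1 / 2 : ℝ)) := by
  obtain ⟨C, hC⟩ := exists_eLpNorm_six_le_ball hE3 (0 : E) ρ
  refine ⟨C, fun y f g hw hf2 => ?_⟩
  have hτ : MeasurePreserving (fun x : E => x + y) volume volume :=
    measurePreserving_add_right volume y
  have hemb : MeasurableEmbedding (fun x : E => x + y) :=
    (Homeomorph.addRight y).measurableEmbedding
  have hpre : (fun x : E => x + y) ⁻¹' ball y ρ = ball 0 ρ := by
    ext x
    simp [mem_ball, dist_eq_norm]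
  have hw' := hasWeakFDerivOn_comp_add_right (Ω' := (⟨ball (0 : E) ρ, isOpen_ball⟩ : Opens E))
    y (by exact hpre.symm) hw
  have hτr : MeasurePreserving (fun x : E => x + y) (volume.restrict (ball 0 ρ))
      (volume.restrict (ball y ρ)) := by
    rw [← hpre]
    exact hτ.restrict_preimage_emb hemb _
  have hfm : AEStronglyMeasurable f (volume.restrict (ball y ρ)) :=
    hw.locallyIntegrableOn.aestronglyMeasurable
  have e2 : eLpNorm (fun x => f (x + y)) 2 (volume.restrict (ball 0 ρ)) =
      eLpNorm f 2 (volume.restrict (ball y ρ)) := eLpNorm_comp_measurePreserving hfm hτr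
  have e6 : eLpNorm (fun x => f (x + y)) 6 (volume.restrict (ball 0 ρ)) =
      eLpNorm f 6 (volume.restrict (ball y ρ)) := eLpNorm_comp_measurePreserving hfm hτr
  have eg : (∫⁻ x in ball (0 : E) ρ, ENNReal.ofReal (frobeniusNormSq (g (x + y)))) =
      ∫⁻ x in ball y ρ, ENNReal.ofReal (frobeniusNormSq (g x)) := by
    rw [← hpre]
    exact hτ.setLIntegral_comp_preimage_emb hemb
      (fun x => ENNReal.ofReal (frobeniusNormSq (g x))) _
  have := hC _ _ hw' (by rw [e2]; exact hf2)
  rwa [e2, e6, eg] at this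

end Sobolev

end Literature.Analysis.FluidPDE
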